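import Summits.QuantumFields.YangMills.Theorems.LuscherReductionTwistedTraceScalingBaseWindow

/-!
# Femto window bookkeeping for route `FemtoCutoffLadder`: how large the bare coupling is in the window, and the
# coupling gap of a matched octave pair

Lead seat `ym-line-fcl-p1` g8 (2026-08-28), for the rev-12 split of `OctaveStepDecay` (stmt-QuantumFields-24153) into
`SmallFieldOctaveStep` (25695) / `LargeFieldInsensitivity` (25696) / glue (25697).  Elementary real analysis on the tree's labels
(`invRunningCoupling = β/2 − 2b₀ log L + (b₁/b₀) log(2b₀/β)`, `luscherLambda = (max invRunningCoupling 0)^{−1/3}`,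
`InFemtoWindow lam β L : 1 ≤ β ∧ lam ≤ Λ ≤ 2 lam`):

* `beta_le_of_window` — **in the window the bare coupling is only logarithmic in the lattice size**:
  `β ≤ 13·(1/lam³ + 2b₀ log L)` (via the tree's linear label bound `TwoLattice.Base.invRunningCoupling_ge'`).  Together with the tree's `four_b0_log_lt_beta_of_window` (`4b₀ log L < β`) this pins
  `β ≈ 2/Λ³ + 4b₀ log L`; in particular `β` is NOT of order `L³/Λ³` along the window, so a per-plaquette large-field threshold
  `β^{κ−1}` is exceeded with probability `≈ e^{−cβ^κ}` that does NOT decay like any power of `L` (used in the lead's note on 25696).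
* `matchedOctave_beta_sub` — **a matched octave pair is separated by a definite coupling gap**: if `(β, 2L')` and `(β', L')` carry the
  same positive running parameter then `4b₀ log 2 ≤ β − β' ≤ 2` (asymptotic freedom: halving the spacing at fixed physical size costs
  `Δβ ≈ 4b₀ log 2 ≈ 0.129`).
* `inv_sub_inv_ge_of_matchedOctave`, `sq_slack_le_telescoping` — consequently `1/β' − 1/β ≥ 4b₀ log 2/(3β'²)`, and any per-lattice
  slack `A/β²` at the two ends of a matched octave pair is absorbed by the telescoping allowance of `OctaveStepDecay`:
  `A/β² + A/β'² ≤ (3A/(2b₀ log 2))·(1/β' − 1/β)`.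

HONEST FRAMING: bookkeeping about labels; nothing here touches a transfer operator.  R2b1 is a RECORD rung — not infinite volume, not a
mass gap, not Clay; no summit is proved by this line.  No definitions, no named facts, no `sorry`.
-/

set_option autoImplicit false

noncomputable section

namespace Summit.QuantumFields.YangMills.Theorems.FemtoTransferGap.WindowCoupling

open Real
open Summit.QuantumFields.YangMills.Theorems.FemtoTransferGap

/-! ## §1 Numerical facts about `b₀`, `b₁` -/

/-- `b₁/b₀ = 17/(44π²)`. [cite: HasenfratzHasenfratz1980, p. 165] -/
theorem b1_div_b0 : b1 / b0 = 17 / (44 * π ^ 2) := by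
  unfold b0 b1
  have hπ : (0 : ℝ) < π := Real.pi_pos
  field_simp
  ring

/-- `b₁/b₀ ≤ 1/20` (since `π² > 9`). [folklore] -/
theorem b1_div_b0_le : b1 / b0 ≤ 1 / 20 := by
  rw [b1_div_b0]
  have hπ : (3 : ℝ) < π := Real.pi_gt_three
  have hπ2 : (9 : ℝ) < π ^ 2 := by nlinarith
  rw [div_le_div_iff₀ (by positivity) (by norm_num)]
  nlinarith

/-- `2b₀ = 11/(12π²) ≤ 11/108` (since `π² > 9`). [folklore] -/
theorem two_b0_le : 2 * b0 ≤ 11 / 108 := by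
  unfold b0
  have hπ : (3 : ℝ) < π := Real.pi_gt_three
  have hπ2 : (9 : ℝ) < π ^ 2 := by nlinarith
  rw [show (2 : ℝ) * (11 / (24 * π ^ 2)) = 11 / (12 * π ^ 2) by ring]
  rw [div_le_div_iff₀ (by positivity) (by norm_num)]
  nlinarith

/-! ## §2 The bare coupling in the window is logarithmic in `L` -/

/-- ★ **In the femto window the bare coupling is logarithmic in the lattice size**: `β ≤ 13·(1/lam³ + 2b₀ log L)` whenever
`(β, L)` lies in the window at level `lam > 0` (`Λ ≥ lam` forces `1/ḡ² ≤ 1/lam³`, and `1/ḡ² ≥ (19/242)β − 2b₀ log L`).  With the tree's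
`four_b0_log_lt_beta_of_window` (`β > 4b₀ log L`) this pins `β` between `4b₀ log L` and `13/lam³ + 26 b₀ log L`: the bare coupling along the
window is NOT of order `L³`. [cite: LuscherMunster1984, §2] -/
theorem beta_le_of_window {lam β : ℝ} {L : ℕ} [NeZero L] (hlam : 0 < lam) (hW : InFemtoWindow lam β L) :
    β ≤ 13 * (1 / lam ^ 3 + 2 * b0 * Real.log (L : ℝ)) := by
  have hβ1 : 1 ≤ β := hW.1
  have hβ0 : 0 < β := by linarith
  have hl : 0 < luscherLambda β L := luscherLambda_pos_of_window hlam hW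
  have hv : 0 < invRunningCoupling β L := BOHandover.invRunningCoupling_pos_of_luscherLambda_pos hl
  -- `1/ḡ² ≤ 1/lam³`
  have h3 : lam ^ 3 ≤ luscherLambda β L ^ 3 := pow_le_pow_left₀ hlam.le hW.2.1 3
  rw [BOHandover.luscherLambda_pow_three hv] at h3
  have hvle : invRunningCoupling β L ≤ 1 / lam ^ 3 := by
    rw [le_div_iff₀ (by positivity), ← le_div_iff₀' hv, div_eq_inv_mul, mul_one]
    exact h3
  have hlin := TwoLattice.Base.invRunningCoupling_ge' hβ0 L
  have hk0 : 0 ≤ b1 / b0 := by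
    have : 0 < b0 := by unfold b0; positivity
    have : 0 < b1 := by unfold b1; positivity
    positivity
  have hlogL : 0 ≤ 2 * b0 * Real.log (L : ℝ) := by
    have : 0 ≤ Real.log (L : ℝ) := Real.log_nonneg (by exact_mod_cast NeZero.one_le)
    have : 0 < b0 := by unfold b0; positivity
    positivity
  have hl3 : 0 < 1 / lam ^ 3 := by positivity
  nlinarith

/-! ## §3 The coupling gap of a matched octave pair -/

/-- Equal positive running parameters mean equal inverse running couplings (`Λ³ = (1/ḡ²)⁻¹` on the asymptotically free side).
[cite: LuscherMunster1984, §2] -/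
theorem invRunningCoupling_eq_of_luscherLambda_eq {β β' : ℝ} {L L' : ℕ} (hl : 0 < luscherLambda β L)
    (hm : luscherLambda β L = luscherLambda β' L') :
    invRunningCoupling β L = invRunningCoupling β' L' := by
  have hl' : 0 < luscherLambda β' L' := hm ▸ hl
  have hv := BOHandover.invRunningCoupling_pos_of_luscherLambda_pos hl
  have hv' := BOHandover.invRunningCoupling_pos_of_luscherLambda_pos hl'
  have h1 := BOHandover.luscherLambda_pow_three hv
  have h2 := BOHandover.luscherLambda_pow_three hv'
  rw [hm] at h1
  rw [h1] at h2
  exact inv_injective h2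

/-- The matching identity of an octave pair: if `(β, 2L')` and `(β', L')` have the same positive running parameter then
`(β − β')/2 − (b₁/b₀)(log β − log β') = 2b₀ log 2`. [cite: LuscherMunster1984, §2] -/
theorem matchedOctave_identity {β β' : ℝ} (hβ : 0 < β) (hβ' : 0 < β') {L' : ℕ} [NeZero L'] {L : ℕ} (hL : L = 2 * L')
    (hl : 0 < luscherLambda β L) (hm : luscherLambda β L = luscherLambda β' L') :
    (β - β') / 2 - b1 / b0 * (Real.log β - Real.log β') = 2 * b0 * Real.log 2 := by
  have heq := invRunningCoupling_eq_of_luscherLambda_eq hl hm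
  rw [BOHandover.invRunningCoupling_eq, BOHandover.invRunningCoupling_eq] at heq
  have hb0 : 0 < b0 := by unfold b0; positivity
  have hL'pos : (0 : ℝ) < (L' : ℝ) := by exact_mod_cast Nat.pos_of_ne_zero (NeZero.ne L')
  have hcast : ((L : ℕ) : ℝ) = 2 * (L' : ℝ) := by rw [hL]; push_cast; ring
  have hlogL : Real.log (L : ℝ) = Real.log 2 + Real.log (L' : ℝ) := by
    rw [hcast, Real.log_mul (by norm_num) hL'pos.ne']
  have hlog1 : Real.log (2 * b0 / β) = Real.log (2 * b0) - Real.log β :=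
    Real.log_div (by positivity) hβ.ne'
  have hlog2 : Real.log (2 * b0 / β') = Real.log (2 * b0) - Real.log β' :=
    Real.log_div (by positivity) hβ'.ne'
  rw [hlogL, hlog1, hlog2] at heq
  linarith

/-- ★ **The coupling gap of a matched octave pair**: for `β, β' ≥ 1` with `(β, 2L')`, `(β', L')` at the same positive running
parameter, `4b₀ log 2 ≤ β − β'` and `β − β' ≤ 2` (the logarithm in the two-loop label moves the one-loop value `4b₀ log 2 ≈ 0.129` by at
most the factor `1/(1 − 2b₁/b₀)`). [cite: LuscherMunster1984, §2] -/
theorem matchedOctave_beta_sub {β β' : ℝ} (hβ : 1 ≤ β) (hβ' : 1 ≤ β') {L' : ℕ} [NeZero L'] {L : ℕ} (hL : L = 2 * L')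
    (hl : 0 < luscherLambda β L) (hm : luscherLambda β L = luscherLambda β' L') :
    4 * b0 * Real.log 2 ≤ β - β' ∧ β - β' ≤ 2 := by
  have hβ0 : 0 < β := by linarith
  have hβ'0 : 0 < β' := by linarith
  have hid := matchedOctave_identity hβ0 hβ'0 hL hl hm
  have hb0 : 0 < b0 := by unfold b0; positivity
  have hb1 : 0 < b1 := by unfold b1; positivity
  have hk0 : 0 ≤ b1 / b0 := (div_pos hb1 hb0).le
  have hk := b1_div_b0_le
  have hlog2 : 0 < Real.log 2 := Real.log_pos (by norm_num)
  have hg : 0 < 2 * b0 * Real.log 2 := by positivity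
  have h2b0 := BOHandover.two_mul_b0_le_one
  have hlog2le : Real.log 2 ≤ 1 := by
    have := Real.log_le_sub_one_of_pos (by norm_num : (0:ℝ) < 2); linarith
  -- first `β' < β`: otherwise the left side of the identity is `≤ 0`
  have hlt : β' < β := by
    by_contra hle
    push Not at hle
    -- `log β' − log β ≤ (β' − β)/β ≤ β' − β`
    have hdiv : 0 < β' / β := by positivity
    have hl1 : Real.log (β' / β) ≤ β' / β - 1 := Real.log_le_sub_one_of_pos hdiv
    rw [Real.log_div hβ'0.ne' hβ0.ne'] at hl1
    have hq : β' / β - 1 = (β' - β) / β := by field_simp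
    rw [hq] at hl1
    have hq2 : (β' - β) / β ≤ β' - β := by
      rw [div_le_iff₀ hβ0]; nlinarith
    have hneg : (β - β') / 2 - b1 / b0 * (Real.log β - Real.log β') ≤ 0 := by
      have : -(b1 / b0) * (Real.log β - Real.log β') ≤ (b1 / b0) * (β' - β) := by nlinarith
      nlinarith
    linarith
  -- lower gap: `log β − log β' ≥ 0`
  have hlogge : 0 ≤ Real.log β - Real.log β' := by
    have := Real.log_le_log hβ'0 hlt.le; linarith
  refine ⟨by nlinarith, ?_⟩
  -- upper gap: `log β − log β' ≤ (β − β')/β' ≤ β − β'`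
  have hdiv : 0 < β / β' := by positivity
  have hl1 : Real.log (β / β') ≤ β / β' - 1 := Real.log_le_sub_one_of_pos hdiv
  rw [Real.log_div hβ0.ne' hβ'0.ne'] at hl1
  have hq : β / β' - 1 = (β - β') / β' := by field_simp
  rw [hq] at hl1
  have hq2 : (β - β') / β' ≤ β - β' := by
    rw [div_le_iff₀ hβ'0]; nlinarith
  have hle : Real.log β - Real.log β' ≤ β - β' := hl1.trans hq2
  -- `(1/2 − b₁/b₀)(β − β') ≤ 2b₀ log 2 ≤ 11/108`, `1/2 − b₁/b₀ ≥ 9/20`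
  have h1 : (1 / 2 - b1 / b0) * (β - β') ≤ 2 * b0 * Real.log 2 := by nlinarith
  have h2 : 2 * b0 * Real.log 2 ≤ 11 / 108 := by
    have := two_b0_le
    calc 2 * b0 * Real.log 2 ≤ 2 * b0 * 1 := mul_le_mul_of_nonneg_left hlog2le (by linarith)
      _ ≤ 11 / 108 := by linarith
  nlinarith

/-- **The telescoping allowance of a matched octave pair is definite**: `1/β' − 1/β ≥ 4b₀ log 2/(3β'²)` (`β − β' ≥ 4b₀ log 2`,
`β ≤ β' + 2 ≤ 3β'`). [folklore] -/
theorem inv_sub_inv_ge_of_matchedOctave {β β' : ℝ} (hβ : 1 ≤ β) (hβ' : 1 ≤ β') {L' : ℕ} [NeZero L'] {L : ℕ} (hL : L = 2 * L')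
    (hl : 0 < luscherLambda β L) (hm : luscherLambda β L = luscherLambda β' L') :
    4 * b0 * Real.log 2 / (3 * β' ^ 2) ≤ 1 / β' - 1 / β := by
  obtain ⟨hlo, hhi⟩ := matchedOctave_beta_sub hβ hβ' hL hl hm
  have hβ0 : 0 < β := by linarith
  have hβ'0 : 0 < β' := by linarith
  have hβle : β ≤ 3 * β' := by linarith
  have heq : 1 / β' - 1 / β = (β - β') / (β' * β) := by field_simp
  rw [heq, div_le_div_iff₀ (by positivity) (by positivity)]
  have hg : 0 ≤ 4 * b0 * Real.log 2 := by
    have hb0 : 0 < b0 := by unfold b0; positivity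
    have := Real.log_pos (by norm_num : (1:ℝ) < 2)
    positivity
  calc 4 * b0 * Real.log 2 * (β' * β) ≤ 4 * b0 * Real.log 2 * (β' * (3 * β')) := by
        apply mul_le_mul_of_nonneg_left _ hg
        exact mul_le_mul_of_nonneg_left hβle hβ'0.le
    _ = 4 * b0 * Real.log 2 * β' ^ 2 * 3 := by ring
    _ ≤ (β - β') * (3 * β' ^ 2) := by nlinarith [sq_nonneg β']

/-- ★ **A per-lattice slack `A/β²` at the two ends of a matched octave pair is absorbed by the telescoping allowance**:
`A/β² + A/β'² ≤ (3A/(2b₀ log 2))·(1/β' − 1/β)` (`A ≥ 0`).  This is what makes an `L`-independent, `β`-decaying large-field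
allowance harmless for the tower assembly `Assembly2` of route `FemtoCutoffLadder`. [folklore] -/
theorem sq_slack_le_telescoping {A β β' : ℝ} (hA : 0 ≤ A) (hβ : 1 ≤ β) (hβ' : 1 ≤ β') {L' : ℕ} [NeZero L'] {L : ℕ}
    (hL : L = 2 * L') (hl : 0 < luscherLambda β L) (hm : luscherLambda β L = luscherLambda β' L') :
    A / β ^ 2 + A / β' ^ 2 ≤ 3 * A / (2 * b0 * Real.log 2) * (1 / β' - 1 / β) := by
  obtain ⟨hlo, -⟩ := matchedOctave_beta_sub hβ hβ' hL hl hm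
  have hgap := inv_sub_inv_ge_of_matchedOctave hβ hβ' hL hl hm
  have hβ0 : 0 < β := by linarith
  have hβ'0 : 0 < β' := by linarith
  have hb0 : 0 < b0 := by unfold b0; positivity
  have hlog2 : 0 < Real.log 2 := Real.log_pos (by norm_num)
  have hg : 0 < 2 * b0 * Real.log 2 := by positivity
  have hβ'le : β' ≤ β := by
    nlinarith
  -- `A/β² ≤ A/β'²`
  have h1 : A / β ^ 2 ≤ A / β' ^ 2 :=
    div_le_div_of_nonneg_left hA (by positivity) (pow_le_pow_left₀ hβ'0.le hβ'le 2)
  -- `2A/β'² = (3A/(2b₀ log 2)) · (4b₀ log 2/(3β'²)) ≤ (3A/(2b₀ log 2)) · (1/β' − 1/β)`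
  have hK : 0 ≤ 3 * A / (2 * b0 * Real.log 2) := by positivity
  have h2 : 3 * A / (2 * b0 * Real.log 2) * (4 * b0 * Real.log 2 / (3 * β' ^ 2)) = 2 * (A / β' ^ 2) := by
    field_simp
    ring
  have h3 := mul_le_mul_of_nonneg_left hgap hK
  rw [h2] at h3
  linarith

/-! ## §4 Along the window a per-plaquette large-field weight `e^{−cβ^κ}` (`κ < 1`) beats every power of `1/L` -/

/-- Sublinear growth of `β ↦ β^κ`, `0 < κ < 1`, in linear form: `β^κ ≤ (β + X)·X^{κ−1}` for `β ≥ 0`, `X > 0`. [folklore] -/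
theorem rpow_le_add_mul_rpow_sub_one {β X κ : ℝ} (hβ : 0 ≤ β) (hX : 0 < X) (hκ0 : 0 ≤ κ) (hκ1 : κ ≤ 1) :
    β ^ κ ≤ (β + X) * X ^ (κ - 1) := by
  set y : ℝ := max β X with hy
  have hyX : X ≤ y := le_max_right _ _
  have hy0 : 0 < y := lt_of_lt_of_le hX hyX
  have h1 : β ^ κ ≤ y ^ κ := Real.rpow_le_rpow hβ (le_max_left _ _) hκ0
  have h2 : y ^ κ = y ^ (κ - 1) * y := by
    rw [Real.rpow_sub_one hy0.ne' κ, Real.rpow_def_of_pos hy0]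
    field_simp
  have h3 : y ^ (κ - 1) ≤ X ^ (κ - 1) := Real.rpow_le_rpow_of_nonpos hX hyX (by linarith)
  have h4 : y ≤ β + X := max_le (by linarith) (by linarith)
  have hXp : 0 ≤ X ^ (κ - 1) := (Real.rpow_pos_of_pos hX _).le
  calc β ^ κ ≤ y ^ κ := h1
    _ = y ^ (κ - 1) * y := h2
    _ ≤ X ^ (κ - 1) * (β + X) := mul_le_mul h3 h4 hy0.le hXp
    _ = (β + X) * X ^ (κ - 1) := by ring

/-- For `0 < κ < 1` and any target `t > 0` there is `X ≥ 1` with `X^{κ−1} ≤ t`. [folklore] -/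
theorem exists_rpow_sub_one_le {κ t : ℝ} (hκ1 : κ < 1) (ht : 0 < t) :
    ∃ X : ℝ, 1 ≤ X ∧ X ^ (κ - 1) ≤ t := by
  set X : ℝ := max 1 ((1 / t) ^ (1 / (1 - κ))) with hX
  have hX1 : 1 ≤ X := le_max_left _ _
  have hX0 : 0 < X := by linarith
  refine ⟨X, hX1, ?_⟩
  have h1κ : 0 < 1 - κ := by linarith
  have hbase : 0 ≤ 1 / t := by positivity
  -- `X^{1−κ} ≥ 1/t`
  have hge : 1 / t ≤ X ^ (1 - κ) := by
    have hm : ((1 / t) ^ (1 / (1 - κ))) ^ (1 - κ) ≤ X ^ (1 - κ) :=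
      Real.rpow_le_rpow (Real.rpow_nonneg hbase _) (le_max_right _ _) h1κ.le
    have hid : ((1 / t) ^ (1 / (1 - κ))) ^ (1 - κ) = 1 / t := by
      rw [← Real.rpow_mul hbase, one_div_mul_cancel h1κ.ne', Real.rpow_one]
    rw [hid] at hm
    exact hm
  have hpos : 0 < X ^ (1 - κ) := Real.rpow_pos_of_pos hX0 _
  have hinv : X ^ (κ - 1) = (X ^ (1 - κ))⁻¹ := by
    rw [← Real.rpow_neg hX0.le, neg_sub]
  rw [hinv, inv_le_comm₀ hpos ht]
  simpa [one_div] using hge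

/-- For `s > 0` and any `M` there is `L1` with `M < L^s` for all `L ≥ L1`. [folklore] -/
theorem exists_nat_rpow_gt {s : ℝ} (hs : 0 < s) (M : ℝ) :
    ∃ L1 : ℕ, ∀ L : ℕ, L1 ≤ L → M < (L : ℝ) ^ s := by
  set A : ℝ := max M 0 + 1 with hA
  have hA0 : 0 < A := by have := le_max_right M 0; linarith
  have hAM : M < A := by have := le_max_left M 0; linarith
  refine ⟨⌈A ^ (1 / s)⌉₊, fun L hL => ?_⟩
  have hLr : A ^ (1 / s) ≤ (L : ℝ) := (Nat.le_ceil _).trans (by exact_mod_cast hL)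
  have hm : (A ^ (1 / s)) ^ s ≤ (L : ℝ) ^ s := Real.rpow_le_rpow (Real.rpow_nonneg hA0.le _) hLr hs.le
  have hid : (A ^ (1 / s)) ^ s = A := by
    rw [← Real.rpow_mul hA0.le, one_div_mul_cancel hs.ne', Real.rpow_one]
  rw [hid] at hm
  exact lt_of_lt_of_le hAM hm

/-- ★ **Along the femto window a per-plaquette large-field weight `e^{−cβ^κ}` (`0 < κ < 1`, `c > 0`) is eventually LARGER than `C/L^σ` for every
`C` and every `σ > 0`** — because `β ≤ 13(1/lam³ + 2b₀ log L)` there (`beta_le_of_window`), so `cβ^κ ≤ (σ/2)·log L + K`.  This is the arithmetic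
reason why a large-field allowance for transfer spectral data on window lattices cannot be asked to decay like a power of `L` (lead's note on
stmt-QuantumFields-25696). [folklore] -/
theorem largeFieldWeight_eventually_gt {lam κ c σ : ℝ} (hlam : 0 < lam) (hκ0 : 0 < κ) (hκ1 : κ < 1) (hc : 0 < c) (hσ : 0 < σ)
    (C : ℝ) :
    ∃ L1 : ℕ, ∀ (L : ℕ) [NeZero L], L1 ≤ L → ∀ β : ℝ, InFemtoWindow lam β L →
      C / (L : ℝ) ^ σ < Real.exp (-(c * β ^ κ)) := by
  have hb0 : 0 < b0 := by unfold b0; positivity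
  -- choose `X ≥ 1` with `26 b₀ c X^{κ−1} ≤ σ/2`
  obtain ⟨X, hX1, hXt⟩ := exists_rpow_sub_one_le hκ1 (show 0 < σ / (52 * b0 * c) by positivity)
  have hX0 : 0 < X := by linarith
  set t : ℝ := X ^ (κ - 1) with ht
  have ht0 : 0 < t := Real.rpow_pos_of_pos hX0 _
  have hct : 26 * b0 * c * t ≤ σ / 2 := by
    have := mul_le_mul_of_nonneg_left hXt (show 0 ≤ 26 * b0 * c by positivity)
    calc 26 * b0 * c * t ≤ 26 * b0 * c * (σ / (52 * b0 * c)) := this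
      _ = σ / 2 := by field_simp; ring
  -- the `L`-independent part of the exponent
  set K : ℝ := c * t * (13 / lam ^ 3 + X) with hK
  -- choose `L1` with `C·e^{K} < L^{σ/2}` beyond it (and `L1 ≥ 1`)
  obtain ⟨L1, hL1⟩ := exists_nat_rpow_gt (half_pos hσ) (C * Real.exp K)
  refine ⟨max L1 1, fun L _ hL β hW => ?_⟩
  have hLL1 : L1 ≤ L := (le_max_left _ _).trans hL
  have hLpos : (0 : ℝ) < (L : ℝ) := by exact_mod_cast Nat.pos_of_ne_zero (NeZero.ne L)
  have hβ1 : 1 ≤ β := hW.1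
  -- `cβ^κ ≤ (σ/2) log L + K`
  have hβle := beta_le_of_window hlam hW
  have hpow : β ^ κ ≤ (β + X) * t := rpow_le_add_mul_rpow_sub_one (by linarith) hX0 hκ0.le hκ1.le
  have hlogL : 0 ≤ Real.log (L : ℝ) := Real.log_nonneg (by exact_mod_cast NeZero.one_le)
  have hexpo : c * β ^ κ ≤ σ / 2 * Real.log (L : ℝ) + K := by
    have h1 : c * β ^ κ ≤ c * ((β + X) * t) := mul_le_mul_of_nonneg_left hpow hc.le
    have h2 : c * ((β + X) * t) ≤ c * ((13 * (1 / lam ^ 3 + 2 * b0 * Real.log (L : ℝ)) + X) * t) := by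
      apply mul_le_mul_of_nonneg_left _ hc.le
      exact mul_le_mul_of_nonneg_right (by linarith) ht0.le
    have h3 : c * ((13 * (1 / lam ^ 3 + 2 * b0 * Real.log (L : ℝ)) + X) * t)
        = (26 * b0 * c * t) * Real.log (L : ℝ) + K := by
      rw [hK]; ring
    have h4 : (26 * b0 * c * t) * Real.log (L : ℝ) ≤ σ / 2 * Real.log (L : ℝ) :=
      mul_le_mul_of_nonneg_right hct hlogL
    linarith
  -- `exp(−cβ^κ) ≥ e^{−K} · L^{−σ/2}`
  have hE : Real.exp (-(σ / 2 * Real.log (L : ℝ) + K)) ≤ Real.exp (-(c * β ^ κ)) :=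
    Real.exp_le_exp.mpr (by linarith)
  have hsplit : Real.exp (-(σ / 2 * Real.log (L : ℝ) + K)) = Real.exp (-K) * (L : ℝ) ^ (-(σ / 2)) := by
    rw [Real.rpow_def_of_pos hLpos, ← Real.exp_add]
    congr 1; ring
  -- compare with `C / L^σ`
  have hLs : 0 < (L : ℝ) ^ σ := Real.rpow_pos_of_pos hLpos σ
  have hgoal : C < Real.exp (-K) * (L : ℝ) ^ (-(σ / 2)) * (L : ℝ) ^ σ := by
    have hcomb : (L : ℝ) ^ (-(σ / 2)) * (L : ℝ) ^ σ = (L : ℝ) ^ (σ / 2) := by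
      rw [← Real.rpow_add hLpos]; congr 1; ring
    rw [mul_assoc, hcomb]
    have hbig : C * Real.exp K < (L : ℝ) ^ (σ / 2) := hL1 L hLL1
    have hEK : 0 < Real.exp (-K) := Real.exp_pos _
    have : C = Real.exp (-K) * (C * Real.exp K) := by
      rw [Real.exp_neg]; field_simp
    rw [this]
    exact mul_lt_mul_of_pos_left hbig hEK
  rw [div_lt_iff₀ hLs]
  calc C < Real.exp (-K) * (L : ℝ) ^ (-(σ / 2)) * (L : ℝ) ^ σ := hgoal
    _ = Real.exp (-(σ / 2 * Real.log (L : ℝ) + K)) * (L : ℝ) ^ σ := by rw [hsplit]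
    _ ≤ Real.exp (-(c * β ^ κ)) * (L : ℝ) ^ σ := mul_le_mul_of_nonneg_right hE hLs.le

end Summit.QuantumFields.YangMills.Theorems.FemtoTransferGap.WindowCoupling

end
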